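import Mathlib

/-!
# HYPOTHESIS V: the level inequality `12 + 12 Σ_{q ∣ N} φ(N/q)/ord_{N/q}(q) < φ(N)` — definitions (`HodgeFermat/HypVDefs.lean`; HF-G33)

Tree copy (whole module) of the module `HodgeFermat/HypVDefs.lean` of the sibling cell's standalone package
`run/shared/lean/pub/pub-hodgefermat/lean/HodgeFermat/` (70 lines, sha256 `a750f4c7c963b2c5…`), source lines 24–70 (all: `tauV`, `IneqV`, `VRange`, `VTail`, `HypV`, the two combinators, `cop210_of_primeFactors`).
Filed by cell `pub-hfermat`, seat prover-1 gen-2, on the COORDINATOR KEEPER RULING of 2026-08-25 (gem sweep H1: take the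
off-gate kernel theorem `thmFstar` through the gate) — here its second namesake, `HodgeFermat/ThmFstarNFinal.lean:29`,
THEOREM F*(3N) at every admissible squarefree level (the first, `DecodingFinal.thmFstar` = THEOREM F* at the prime levels,
landed on 2026-08-25 as `HodgeFermatThmFstar.lean`, seat prover-1 gen-0); this file is one link of the import closure of
`ThmFstarNFinal.thmFstar` on top of that landed chain.  The source module's declarations are VERBATIM those of the cell record
`check/ThmFstarN_standalone.lean` (21 bodies, 438 871 B, sha256 ced731ec52c92191…, hub `lean check` rc 0, 222.2 s, `--axioms …ThmFstarN.thmFstarN` = [propext, Classical.choice, Quot.sound]; pub-hodgefermat `CERT.md` l.987, GATE HF-G33).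
Deviations from the source module, exhaustively: the `import` lines (tree modules `Summits.HodgeConjecture.FermatCycles.
HodgeFermat*` instead of `HodgeFermat.*`); this module docstring; one-line docstrings added (gate lint) to `vRange_append`, `hypV_of_range_tail`.
Every other line — in particular every declaration's statement and proof — is byte-identical to the source.
HONEST FRAMING: explicit algebraic cycles for specific Hodge classes on Fermat/Delsarte varieties; residual open instances
listed; no claim on general Hodge.  (This file is arithmetic of CM types / of `(ℤ/N)ˣ`; it claims nothing about cycles.)

The source module's docstring (HypVDefs.lean l.6–22), verbatim:

## HYPOTHESIS V: the level inequality for the Bad coefficients at composite level (HF-G33)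

For a level `N` and a prime `q ∣ N` put `tauV N q = φ(N/q) / ord_{N/q}(q)` (for squarefree `N` this is the
number of Dirichlet characters mod `N/q` trivial at `q`, i.e. the order of the subgroup `K_q` of characters mod `N`
whose primitive character is `1` at `q`).  HYPOTHESIS V at the level `N` is the inequality

  `IneqV N : 12 + 12 · Σ_{q ∣ N prime} tauV N q < φ(N)`,

which (`BadVanish.lean`) makes the coefficients of `μ_T − μ_T′` / `ν_T − ν_T′` at the BAD characters vanish by the
uncertainty principle on `(ℤ/N)ˣ`.  It holds for every squarefree `N ≥ 25` prime to `210` (`HypV`): for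
`N ≤ 30000` by the certificate-free kernel walk `HypVCert.lean` / `HypVRange.lean`, beyond by the analytic tail
`HypVTail.lean`; the primes `11 … 23` are the only squarefree numbers prime to `210` where it fails, and a prime
level needs no Bad coefficients anyway (`LemmaEGood.thmFstar_prime`).

`import Mathlib` only.
-/

set_option autoImplicit false

namespace HodgeFermat.KRFree.HypVDefs

open Finset

/-- `tauV N q = φ(N/q) / ord_{N/q}(q)`. -/
noncomputable def tauV (N q : ℕ) : ℕ := (N / q).totient / orderOf ((q : ℕ) : ZMod (N / q))

/-- the level inequality of HYPOTHESIS V at `N` -/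
def IneqV (N : ℕ) : Prop := 12 + 12 * ∑ q ∈ N.primeFactors, tauV N q < N.totient

/-- HYPOTHESIS V on the range `a ≤ N < b` (squarefree `N` prime to `210`). -/
def VRange (a b : ℕ) : Prop :=
  ∀ N, a ≤ N → N < b → Squarefree N → ¬ 2 ∣ N → ¬ 3 ∣ N → ¬ 5 ∣ N → ¬ 7 ∣ N → IneqV N

/-- HYPOTHESIS V beyond `X`. -/
def VTail (X : ℕ) : Prop :=
  ∀ N, X < N → Squarefree N → ¬ 2 ∣ N → ¬ 3 ∣ N → ¬ 5 ∣ N → ¬ 7 ∣ N → IneqV N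

/-- HYPOTHESIS V: every squarefree `N ≥ 25` prime to `210` satisfies `IneqV N`. -/
def HypV : Prop :=
  ∀ N, 25 ≤ N → Squarefree N → ¬ 2 ∣ N → ¬ 3 ∣ N → ¬ 5 ∣ N → ¬ 7 ∣ N → IneqV N

/-- glue two adjacent ranges of HYPOTHESIS V -/
theorem vRange_append {a b c : ℕ} (h1 : VRange a b) (h2 : VRange b c) : VRange a c := by
  intro N ha hc hsq h2N h3N h5N h7N
  by_cases hb : N < b
  · exact h1 N ha hb hsq h2N h3N h5N h7N
  · exact h2 N (by omega) hc hsq h2N h3N h5N h7N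

/-- HYPOTHESIS V from the range `25 ≤ N ≤ X` and the tail `N > X` -/
theorem hypV_of_range_tail {X : ℕ} (hR : VRange 25 (X + 1)) (hT : VTail X) : HypV := by
  intro N h25 hsq h2N h3N h5N h7N
  by_cases hX : N < X + 1
  · exact hR N h25 hX hsq h2N h3N h5N h7N
  · exact hT N (by omega) hsq h2N h3N h5N h7N

/-- a positive `N` all of whose prime factors are `≥ 11` is prime to `210` -/
theorem cop210_of_primeFactors {N : ℕ} (hN : 0 < N) (h : ∀ p ∈ N.primeFactors, 11 ≤ p) :
    ¬ 2 ∣ N ∧ ¬ 3 ∣ N ∧ ¬ 5 ∣ N ∧ ¬ 7 ∣ N := by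
  have key : ∀ p, p.Prime → p < 11 → ¬ p ∣ N := by
    intro p hp hlt hdvd
    have := h p (Nat.mem_primeFactors.mpr ⟨hp, hdvd, hN.ne'⟩)
    omega
  exact ⟨key 2 Nat.prime_two (by norm_num), key 3 Nat.prime_three (by norm_num),
    key 5 (by norm_num) (by norm_num), key 7 (by norm_num) (by norm_num)⟩

end HodgeFermat.KRFree.HypVDefs
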